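import Summits.QuantumFields.YangMills.Theorems.QuantileBitPuritySectorGoodReduction
import Summits.QuantumFields.YangMills.Theorems.QuantileBitPuritySectorPinning
import HarnessLib

/-!
# The four `x`-twisted seam sectors carry only bad fields below the equator: their weight of any slice-`0` event `{polDist ≤ c}`, `c < 2 − L(n+1)t`,
# is at most the (negligible) weight of the complement of the good-field event

Support module (`--supports` stmt-QuantumFields-23948; memo HOME `bc/g14-dw/SECTORS-translates.md` §1(a)–§2).  Combines the pinning lemma
`FlatSheet.two_sub_le_polDist_of_twisted_sector` (`Theorems/QuantileBitPuritySectorPinning.lean`: in a sector with `z 0 = true`, a chain whose consecutive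
slices AND seam pair are linkwise `t`-close has `polDist U_0 ≥ 2 − L(n+1)t`) with the good-field event `TT.goodEvent` (defs `QuantileBitPuritySectorGoodDefs`)
and its negligible complement (`TT.sectorWeight_indicator_compl_goodEvent_le_floor`, `Theorems/QuantileBitPuritySectorGoodReduction.lean`):

* ★ `goodEvent_subset_polDist_ge`: `goodEvent n z s t ⊆ {polDist U_0 ≥ 2 − L(n+1)t}` when `z 0 = true`;
* ★ `sectorWeight_indicator_polDist_le_of_twisted`: for `z 0 = true` and `c < 2 − L(n+1)t`,
  `sectorWeight β n z 𝟙{polDist U_0 ≤ c} ≤ sectorWeight β n z 𝟙_{goodᶜ} ≤ (n+1)(e^{−βs/2} + e^{−βt²/2})(β^N)^{n+1} Z_phys(L, β, n+1)`.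

So cores `{polDist ≤ β^{-γc}}` and strips `{|polDist − c| ≤ β^{-γ}}` with `c + β^{-γ} < 2 − L(n+1)t` receive from the `x`-twisted sectors only a
`β^{-a}`-negligible weight (choose `βs/2 = βt²/2 = ((n+1)N + a + 1) log β`); the memo's electric-flux obstruction sits in the OTHER twisted sectors
(`z 0 = false`, `z ≠ 0`: untwisted holonomy pinned to the centre) and, for strips at `c ≈ 2`, in these.  HONEST FRAMING: fixed-lattice bookkeeping; nothing
about infinite volume, the continuum limit or the Clay gap.  No `sorry`, no new axiom, no new definition.  References: [cite: tHooft1979]; [cite: Luscher1983, §2].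
-/

set_option autoImplicit false

noncomputable section

open MeasureTheory Filter Topology Real Function
open scoped BigOperators
open Literature.MathematicalPhysics.QuantumLattice
open Literature.MathematicalPhysics.QuantumFieldTheory hiding SU2
open Summit.QuantumFields.YangMills.Theorems

namespace Summit.QuantumFields.YangMills.Theorems.FemtoTransferGap.TT

open Summit.QuantumFields.YangMills.Theorems.FemtoTransferGap
open Summit.QuantumFields.YangMills.Theorems.FemtoTransferGap.FlatSheet

variable {L : ℕ} [NeZero L]

/-- ★ **On the good-field event of an `x`-twisted sector the `x`-holonomy sits at the equator**: `z 0 = true` and `(g, U⃗) ∈ goodEvent n z s t` give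
`2 − L(n+1)t ≤ polDist U_0`. [cite: tHooft1979] [cite: Luscher1983, §2] -/
theorem two_sub_le_polDist_of_mem_goodEvent {z : Fin 3 → Bool} (hz : z 0 = true) {n : ℕ} {s t : ℝ}
    {p : (Site 3 L → SU2) × (Fin (n + 1) → GaugeConfig 3 L SU2)} (hp : p ∈ goodEvent n z s t) :
    2 - L * ((n + 1) * t) ≤ polDist (p.2 0) := by
  rw [mem_goodEvent_iff] at hp
  obtain ⟨-, hbond, hseam⟩ := hp
  refine two_sub_le_polDist_of_twisted_sector hz p.2 p.1 (fun i j _ => ?_) (fun j _ => ?_)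
  · rw [← frobNorm_neg, neg_sub]; exact hbond i (lineEdge L j)
  · rw [← frobNorm_neg, neg_sub]; exact hseam (lineEdge L j)

/-- ★ **Good fields of an `x`-twisted sector avoid every slice-`0` event below the equator**: for `z 0 = true` and `c < 2 − L(n+1)t`,
`goodEvent n z s t ∩ {polDist U_0 ≤ c} = ∅`, i.e. pointwise `𝟙{polDist U_0 ≤ c} ≤ 𝟙_{goodᶜ}`. [cite: tHooft1979] [cite: Luscher1983, §2] -/
theorem indicator_polDist_le_indicator_compl_goodEvent {z : Fin 3 → Bool} (hz : z 0 = true) (n : ℕ) (s : ℝ) {t c : ℝ}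
    (hc : c < 2 - L * ((n + 1) * t)) (Us : Fin (n + 1) → GaugeConfig 3 L SU2) (g : Site 3 L → SU2) :
    Set.indicator {U : GaugeConfig 3 L SU2 | polDist U ≤ c} (fun _ => (1 : ℝ)) (Us 0) ≤
      (goodEvent (L := L) n z s t)ᶜ.indicator (fun _ => (1 : ℝ)) (g, Us) := by
  by_cases hU : Us 0 ∈ {U : GaugeConfig 3 L SU2 | polDist U ≤ c}
  · have hbad : (g, Us) ∈ (goodEvent (L := L) n z s t)ᶜ := by
      intro hgood
      have h := two_sub_le_polDist_of_mem_goodEvent (L := L) hz hgood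
      have hU' : polDist (Us 0) ≤ c := hU
      simp only at h
      linarith
    rw [Set.indicator_of_mem hU, Set.indicator_of_mem hbad]
  · rw [Set.indicator_of_notMem hU]
    exact Set.indicator_nonneg (fun _ _ => zero_le_one) _

/-- ★ **The `x`-twisted sectors carry only bad fields below the equator**: for `z 0 = true`, `c < 2 − L(n+1)t`, `t ≥ 0`, `β ≥ max(9, 4/w₀)`, `n ≥ 1`,
`sectorWeight β n z 𝟙{polDist U_0 ≤ c} ≤ (n+1)(e^{−βs/2} + e^{−βt²/2})(β^N)^{n+1} · Z_phys(L, β, n+1)`. [cite: tHooft1979] [cite: Luscher1983, §2] -/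
theorem sectorWeight_indicator_polDist_le_of_twisted {z : Fin 3 → Bool} (hz : z 0 = true) {n : ℕ} (hn : 1 ≤ n) {β : ℝ} (hβ9 : 9 ≤ β)
    (hβw : 4 / (Real.exp (-(1 / 2 : ℝ)) * (8 / (3 * π ^ 3))) ≤ β) (s : ℝ) {t c : ℝ} (ht : 0 ≤ t) (hc : c < 2 - L * ((n + 1) * t)) :
    sectorWeight β n z (fun Us _ => Set.indicator {U : GaugeConfig 3 L SU2 | polDist U ≤ c} (fun _ => (1 : ℝ)) (Us 0)) ≤
      (n + 1) * (Real.exp (-(β / 2 * s)) + Real.exp (-(β * t ^ 2 / 2))) *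
        (β ^ (8 * Fintype.card (Plaquette 3 L) + 97 * Fintype.card (Edge 3 L))) ^ (n + 1) * physTraceSucc L β n := by
  have hA : MeasurableSet {U : GaugeConfig 3 L SU2 | polDist U ≤ c} := measurableSet_le measurable_polDist measurable_const
  have hFm : Measurable (uncurry fun (Us : Fin (n + 1) → GaugeConfig 3 L SU2) (_g : Site 3 L → SU2) =>
      Set.indicator {U : GaugeConfig 3 L SU2 | polDist U ≤ c} (fun _ => (1 : ℝ)) (Us 0)) :=
    measurable_uncurry_slice_zero (measurable_const.indicator hA)
  have hGm : Measurable (uncurry fun (Us : Fin (n + 1) → GaugeConfig 3 L SU2) (g : Site 3 L → SU2) =>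
      (goodEvent (L := L) n z s t)ᶜ.indicator (fun _ => (1 : ℝ)) (g, Us)) :=
    (measurable_const.indicator (measurableSet_goodEvent (L := L) n z s t).compl).comp (measurable_snd.prodMk measurable_fst)
  have hmono := sectorWeight_mono (L := L) β n z hFm hGm (fun Us _ => abs_indicator_one_le _ (Us 0)) (fun Us g => abs_indicator_one_le _ (g, Us))
    fun Us g => indicator_polDist_le_indicator_compl_goodEvent (L := L) hz n s hc Us g
  exact hmono.trans (sectorWeight_indicator_compl_goodEvent_le_floor (L := L) hn hβ9 hβw z s ht)

end Summit.QuantumFields.YangMills.Theorems.FemtoTransferGap.TT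

end
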